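import Summits.KontsevichZagierPeriods.KontsevichZagierPeriods.Theorems.RootDecompWalshStrataHtypeLineEuler

/-!
# Root decomposition (Walsh strata), part 54 — H-type fibre discriminants IX: the generic conic-edge family

The conic-edge residual `R-HCx` of part 52 is the family of one-variable integrals

  `∫_S γ · Hi · n · (m ℓ + s q₂ √Δ)² / (H² √Δ) dx`,
  `H = e x² + g`, `Hi = (e/3) x³ + g x`, `n = q₁ g − e q₀ x`, `ℓ = q₀ + q₁ x`, `s = ±1`,
  `Δ = (m + q₂²) H − m ℓ² = E′x² + F′x + G′`, `E′ = (m + q₂²) e − m q₁²`, `F′ = −2 m q₀ q₁`,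
  `G′ = (m + q₂²) g − m q₀²`,

over semialgebraic `S ⊆ [0, 1] ∩ {H > 0} ∩ {Δ > 0}`.  Expanding the square (`s² = 1`, `(√Δ)² = Δ`),

  `integrand = 2 s m q₂ γ Hi n ℓ / H²  +  γ Hi n (m² ℓ² + q₂² Δ) / (H² √Δ)`:

a RATIONAL summand (peeled with `InBaker.peel_rat`, ConicClass) plus an Euler terminal of the shape
`N/Q/√Δ` (`InBaker.sqrt_rational_div`, EulerDescent12).  This part CLOSES the family for every
NON-DEGENERATE radicand `E′ (4 E′ G′ − F′²) ≠ 0`, with the hull analysis of part 53: hull `[0, 1]` if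
`g > 0`; a rational hull `[lo, 1]` beyond the vertex `x⋆ = √(−g/e)` if `g ≤ 0` and `ℓ(x⋆) ≠ 0` (then
`Δ(x⋆) < 0` and `S` keeps a definite distance from `x⋆`); and the pole-cancelled forms
`2 s m q₂ γ q₁² ρ Hi /(e (x + ρ)²) + γ q₁ ρ Hi (m² q₁² (x − ρ) + q₂² δ₂)/(e (x + ρ)² √Δ)`, `Δ = (x − ρ) δ₂`, on
the hull `[0, 1]` if `ℓ(x⋆) = 0`, `x⋆ = ρ = −q₀/q₁ ∈ ℚ`, `g = −e ρ²`.

The head becomes `quadricBakerDescent_of_residuals₇ : R-HLx° → R-HCx° → R-Eθ → QuadricBakerDescent`, both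
one-variable residuals now restricted to their DEGENERATE radicands (linear, constant or perfect square).

References: [KontsevichZagier2001 §1.2 rules (1)–(3)], [BCR1998 §2.2].
-/

noncomputable section

open Set MeasureTheory MvPolynomial Literature.NumberTheory.Transcendental
open Literature.ModelTheory.ExponentialFields (IsSemialgebraic isSemialgebraic_univ isSemialgebraic_empty)
open Summit.KontsevichZagierPeriods.RootDecompWalshStrata.ConicDescent.VertexChart

namespace Summit.KontsevichZagierPeriods.RootDecompWalshStrata.ConicDescent.BallCube

/-! #### 54.1 The Euler data of the conic-edge family -/

/-- Rational summand numerator `2 s m q₂ γ · Hi · n · ℓ ∈ ℚ[X]` of the conic-edge integrand. [this node] -/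
def hCxNA (e g m γ q0 q1 q2 s : ℚ) : Polynomial ℚ :=
  Polynomial.C (2 * s * m * q2 * γ) * hPi e g * (Polynomial.C (q1 * g) - Polynomial.C (e * q0) * Polynomial.X) *
    (Polynomial.C q0 + Polynomial.C q1 * Polynomial.X)

/-- `hCxNA(x) = 2 s m q₂ γ Hi(x) n(x) ℓ(x)`. [bookkeeping] -/
theorem aeval_hCxNA (e g m γ q0 q1 q2 s : ℚ) (x : ℝ) :
    Polynomial.aeval x (hCxNA e g m γ q0 q1 q2 s) =
      2 * (s : ℝ) * m * q2 * γ * ((e : ℝ) / 3 * x ^ 3 + g * x) * ((q1 : ℝ) * g - e * q0 * x) *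
        ((q0 : ℝ) + q1 * x) := by
  simp only [hCxNA, map_mul, map_sub, map_add, Polynomial.aeval_C, Polynomial.aeval_X, eq_ratCast,
    aeval_hPi]
  push_cast
  ring

/-- Euler numerator `γ · Hi · n · (m² ℓ² + q₂² Δ) ∈ ℚ[X]` of the conic-edge integrand. [this node] -/
def hCxNB (e g m γ q0 q1 q2 : ℚ) : Polynomial ℚ :=
  Polynomial.C γ * hPi e g * (Polynomial.C (q1 * g) - Polynomial.C (e * q0) * Polynomial.X) *
    (Polynomial.C (m ^ 2) * (Polynomial.C q0 + Polynomial.C q1 * Polynomial.X) ^ 2 +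
      Polynomial.C (q2 ^ 2) * (Polynomial.C (m + q2 ^ 2) * hP e g -
        Polynomial.C m * (Polynomial.C q0 + Polynomial.C q1 * Polynomial.X) ^ 2))

/-- `hCxNB(x) = γ Hi(x) n(x) (m² ℓ(x)² + q₂² Δ(x))`. [bookkeeping] -/
theorem aeval_hCxNB (e g m γ q0 q1 q2 : ℚ) (x : ℝ) :
    Polynomial.aeval x (hCxNB e g m γ q0 q1 q2) =
      (γ : ℝ) * ((e : ℝ) / 3 * x ^ 3 + g * x) * ((q1 : ℝ) * g - e * q0 * x) *
        ((m : ℝ) ^ 2 * ((q0 : ℝ) + q1 * x) ^ 2 +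
          (q2 : ℝ) ^ 2 * (((m : ℝ) + q2 ^ 2) * ((e : ℝ) * x ^ 2 + g) - m * ((q0 : ℝ) + q1 * x) ^ 2)) := by
  simp only [hCxNB, map_mul, map_sub, map_add, map_pow, Polynomial.aeval_C, Polynomial.aeval_X,
    eq_ratCast, aeval_hPi, aeval_hP]

/-- Rational summand numerator `2 s m q₂ γ q₁² ρ · Hi` of the vertex-conic case (`q₀ = −q₁ ρ`, `g = −e ρ²`).
[this node] -/
def hCxNAv (e m γ q1 q2 s ρ : ℚ) : Polynomial ℚ :=
  Polynomial.C (2 * s * m * q2 * γ * q1 ^ 2 * ρ) * hPi e (-(e * ρ ^ 2))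

/-- `hCxNAv(x) = 2 s m q₂ γ q₁² ρ (e x³/3 − e ρ² x)`. [bookkeeping] -/
theorem aeval_hCxNAv (e m γ q1 q2 s ρ : ℚ) (x : ℝ) :
    Polynomial.aeval x (hCxNAv e m γ q1 q2 s ρ) =
      2 * (s : ℝ) * m * q2 * γ * q1 ^ 2 * ρ * ((e : ℝ) / 3 * x ^ 3 + -((e : ℝ) * ρ ^ 2) * x) := by
  simp only [hCxNAv, map_mul, Polynomial.aeval_C, eq_ratCast, aeval_hPi]
  push_cast
  ring

/-- Euler numerator `γ q₁ ρ · Hi · (m² q₁² (X − ρ) + q₂² δ₂)` of the vertex-conic case,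
`δ₂ = ((m + q₂²) e − m q₁²) X + ((m + q₂²) e + m q₁²) ρ`. [this node] -/
def hCxNBv (e m γ q1 q2 ρ : ℚ) : Polynomial ℚ :=
  Polynomial.C (γ * q1 * ρ) * hPi e (-(e * ρ ^ 2)) *
    (Polynomial.C (m ^ 2 * q1 ^ 2) * (Polynomial.X - Polynomial.C ρ) +
      Polynomial.C (q2 ^ 2) * (Polynomial.C ((m + q2 ^ 2) * e - m * q1 ^ 2) * Polynomial.X +
        Polynomial.C (((m + q2 ^ 2) * e + m * q1 ^ 2) * ρ)))

/-- `hCxNBv(x) = γ q₁ ρ (e x³/3 − e ρ² x)(m² q₁² (x − ρ) + q₂² δ₂(x))`. [bookkeeping] -/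
theorem aeval_hCxNBv (e m γ q1 q2 ρ : ℚ) (x : ℝ) :
    Polynomial.aeval x (hCxNBv e m γ q1 q2 ρ) =
      (γ : ℝ) * q1 * ρ * ((e : ℝ) / 3 * x ^ 3 + -((e : ℝ) * ρ ^ 2) * x) *
        ((m : ℝ) ^ 2 * q1 ^ 2 * (x - ρ) +
          (q2 : ℝ) ^ 2 * ((((m : ℝ) + q2 ^ 2) * e - m * q1 ^ 2) * x + (((m : ℝ) + q2 ^ 2) * e + m * q1 ^ 2) * ρ)) := by
  simp only [hCxNBv, map_mul, map_sub, map_add, Polynomial.aeval_C, Polynomial.aeval_X, eq_ratCast,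
    aeval_hPi]
  push_cast
  ring

/-- The conic-edge radicand is the quadratic `qD ((m + q₂²) e − m q₁²) (−2 m q₀ q₁) ((m + q₂²) g − m q₀²)`.
[bookkeeping] -/
theorem hCx_rad (e g m q0 q1 q2 : ℚ) (x : ℝ) :
    ((m : ℝ) + q2 ^ 2) * ((e : ℝ) * x ^ 2 + g) - m * ((q0 : ℝ) + q1 * x) ^ 2 =
      qD ((m + q2 ^ 2) * e - m * q1 ^ 2) (-(2 * m * q0 * q1)) ((m + q2 ^ 2) * g - m * q0 ^ 2) x := by
  simp only [qD]; push_cast; ring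

/-! #### 54.2 The generic conic-edge family -/

/-- **The conic-edge family with non-degenerate radicand is in the Baker sector.**  For
`E′ (4 E′ G′ − F′²) ≠ 0` every member of `R-HCx` is a rational representation plus an Euler terminal:
`peel_rat` + `sqrt_rational_div` on the hull `[0, 1]` (`g > 0`), on a rational hull `[lo, 1]` beyond the
vertex (`g ≤ 0`, `ℓ(x⋆) ≠ 0`), or with the pole-cancelled numerators over `e (x + ρ)²` on `[0, 1]` when
`ℓ` vanishes at the vertex point `(ρ, 0)`, `ρ = √(−g/e) ∈ ℚ`. [KontsevichZagier2001 §1.2 rules (1)–(3); this node] -/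
theorem InBaker.of_HCx_generic (e g m γ q0 q1 q2 s : ℚ) (he : 0 < e) (hm : 1 ≤ m) (hs : s = 1 ∨ s = -1)
    (hnd : ((m + q2 ^ 2) * e - m * q1 ^ 2) *
      (4 * ((m + q2 ^ 2) * e - m * q1 ^ 2) * ((m + q2 ^ 2) * g - m * q0 ^ 2) - (2 * m * q0 * q1) ^ 2) ≠ 0)
    (S : Set (Fin 1 → ℝ)) (hS : IsSemialgebraic ℚ S)
    (hdom : ∀ t ∈ S, (0 ≤ t 0 ∧ t 0 ≤ 1) ∧ 0 < (e : ℝ) * t 0 ^ 2 + g ∧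
      0 < ((m : ℝ) + q2 ^ 2) * ((e : ℝ) * t 0 ^ 2 + g) - m * ((q0 : ℝ) + q1 * t 0) ^ 2)
    (r : KZ.IntegralRep 1) (hrd : r.domain = S)
    (hri : EqOn r.integrand (fun t => (γ : ℝ) * ((e : ℝ) / 3 * t 0 ^ 3 + g * t 0) * ((q1 : ℝ) * g - e * q0 * t 0) *
      ((m : ℝ) * ((q0 : ℝ) + q1 * t 0) +
        s * q2 * √(((m : ℝ) + q2 ^ 2) * ((e : ℝ) * t 0 ^ 2 + g) - m * ((q0 : ℝ) + q1 * t 0) ^ 2)) ^ 2 /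
      (((e : ℝ) * t 0 ^ 2 + g) ^ 2 *
        √(((m : ℝ) + q2 ^ 2) * ((e : ℝ) * t 0 ^ 2 + g) - m * ((q0 : ℝ) + q1 * t 0) ^ 2))) S) :
    InBaker (KZ.of r) := by
  have _hS := hS
  subst hrd
  have he0 : (0 : ℝ) < e := by exact_mod_cast he
  have hm0 : (0 : ℝ) < m := by exact_mod_cast zero_lt_one.trans_le hm
  have hs2 : (s : ℝ) ^ 2 = 1 := by rcases hs with h | h <;> simp [h]
  have hE' : (m + q2 ^ 2) * e - m * q1 ^ 2 ≠ 0 := left_ne_zero_of_mul hnd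
  have hH' : (m + q2 ^ 2) * g - m * q0 ^ 2 - (-(2 * m * q0 * q1)) ^ 2 / (4 * ((m + q2 ^ 2) * e - m * q1 ^ 2)) ≠ 0 := by
    intro h0
    apply hnd
    have h1 : 4 * ((m + q2 ^ 2) * e - m * q1 ^ 2) * ((m + q2 ^ 2) * g - m * q0 ^ 2) - (2 * m * q0 * q1) ^ 2 =
        4 * ((m + q2 ^ 2) * e - m * q1 ^ 2) * ((m + q2 ^ 2) * g - m * q0 ^ 2 -
          (-(2 * m * q0 * q1)) ^ 2 / (4 * ((m + q2 ^ 2) * e - m * q1 ^ 2))) := by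
      field_simp
    rw [h1, h0, mul_zero, mul_zero]
  have hI01 : ∀ v ∈ r.domain, ((0 : ℚ) : ℝ) ≤ v 0 ∧ v 0 ≤ ((1 : ℚ) : ℝ) := fun v hv => by
    obtain ⟨⟨h0, h1⟩, -⟩ := hdom v hv
    exact ⟨by exact_mod_cast h0, by exact_mod_cast h1⟩
  -- the vertex `x⋆ = √(-g/e)` (relevant for `g ≤ 0` only)
  obtain ⟨xs, hxs⟩ : ∃ xs : ℝ, xs = √(-(g : ℝ) / e) := ⟨_, rfl⟩
  have hxs0 : 0 ≤ xs := by rw [hxs]; exact Real.sqrt_nonneg _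
  by_cases hvx : g ≤ 0 ∧ (q0 : ℝ) + q1 * xs = 0
  · -- `g ≤ 0` and `ℓ` vanishes at the vertex point
    obtain ⟨hg, hlam⟩ := hvx
    have hg0 : (g : ℝ) ≤ 0 := by exact_mod_cast hg
    have hxs2 : xs ^ 2 = -(g : ℝ) / e := by
      rw [hxs, Real.sq_sqrt (div_nonneg (neg_nonneg.2 hg0) he0.le)]
    rcases eq_or_ne q1 0 with hq1 | hq1
    · -- `q₁ = 0`, hence `q₀ = 0`: `n ≡ 0`, the integrand vanishes identically
      subst hq1
      have hq0 : (q0 : ℝ) = 0 := by simpa using hlam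
      have hq0' : q0 = 0 := by exact_mod_cast hq0
      subst hq0'
      exact InBaker.of_eqOn_ratCast r 0 fun v hv => by rw [hri hv]; simp
    · obtain ⟨ρ, hρ⟩ : ∃ ρ : ℚ, q0 = -(q1 * ρ) := ⟨-q0 / q1, by field_simp⟩
      subst hρ
      have hq1r : (q1 : ℝ) ≠ 0 := by exact_mod_cast hq1
      have hxsρ : xs = ρ := by
        push_cast at hlam
        have h1 : (q1 : ℝ) * (xs - ρ) = 0 := by linarith
        rcases mul_eq_zero.1 h1 with h2 | h2
        · exact absurd h2 hq1r
        · linarith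
      subst hxsρ
      have hgρr : (g : ℝ) = -(e * ρ ^ 2) := by
        have h1 := hxs2
        field_simp at h1
        linarith
      have hgρ : g = -(e * ρ ^ 2) := by exact_mod_cast hgρr
      subst hgρ
      rcases eq_or_ne ρ 0 with hρ0 | hρ0
      · subst hρ0
        exact InBaker.of_eqOn_ratCast r 0 fun v hv => by rw [hri hv]; simp
      · have hρpos : (0 : ℝ) < ρ := lt_of_le_of_ne hxs0 (Ne.symm (by exact_mod_cast hρ0))
        have hQv : ∀ x : ℝ, ((0 : ℚ) : ℝ) ≤ x → x ≤ ((1 : ℚ) : ℝ) → Polynomial.aeval x (hLxQv e ρ) ≠ 0 := by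
          intro x hx _
          have hx0 : (0 : ℝ) ≤ x := by exact_mod_cast hx
          rw [aeval_hLxQv]
          positivity
        refine InBaker.peel_rat (hCxNAv e m γ q1 q2 s ρ) (hLxQv e ρ) 0 1 hQv r hI01
          (fun v => Polynomial.aeval (v 0) (hCxNBv e m γ q1 q2 ρ) / Polynomial.aeval (v 0) (hLxQv e ρ) /
            √(qD ((m + q2 ^ 2) * e - m * q1 ^ 2) (-(2 * m * -(q1 * ρ) * q1))
              ((m + q2 ^ 2) * -(e * ρ ^ 2) - m * (-(q1 * ρ)) ^ 2) (v 0)))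
          (fun v hv => ?_) fun rB hBd hBi =>
            InBaker.sqrt_rational_div _ _ _ hE' hH' (hCxNBv e m γ q1 q2 ρ) (hLxQv e ρ) 0 1 hQv rB
              (fun v hv => hI01 v (by rw [hBd] at hv; exact hv)) hBi
        -- the integrand identity in the vertex case
        obtain ⟨⟨h0, -⟩, hH, hΔ⟩ := hdom v hv
        have hpos : 0 < qD ((m + q2 ^ 2) * e - m * q1 ^ 2) (-(2 * m * -(q1 * ρ) * q1))
            ((m + q2 ^ 2) * -(e * ρ ^ 2) - m * (-(q1 * ρ)) ^ 2) (v 0) := by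
          rw [← hCx_rad]; exact hΔ
        obtain ⟨w, hw⟩ : ∃ w : ℝ, w = √(qD ((m + q2 ^ 2) * e - m * q1 ^ 2) (-(2 * m * -(q1 * ρ) * q1))
            ((m + q2 ^ 2) * -(e * ρ ^ 2) - m * (-(q1 * ρ)) ^ 2) (v 0)) := ⟨_, rfl⟩
        have hw0 : w ≠ 0 := by rw [hw]; exact (Real.sqrt_pos.2 hpos).ne'
        have hw2 : w ^ 2 = ((m : ℝ) + q2 ^ 2) * ((e : ℝ) * v 0 ^ 2 + ((-(e * ρ ^ 2) : ℚ) : ℝ)) -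
            m * ((((-(q1 * ρ)) : ℚ) : ℝ) + q1 * v 0) ^ 2 := by
          rw [hw, Real.sq_sqrt hpos.le, ← hCx_rad]
        have hD : ((e : ℝ) * v 0 ^ 2 + ((-(e * ρ ^ 2) : ℚ) : ℝ)) ^ 2 ≠ 0 := pow_ne_zero 2 hH.ne'
        have hQ0 : (e : ℝ) * (v 0 + ρ) ^ 2 ≠ 0 := by positivity
        rw [hri hv]
        dsimp only
        rw [hCx_rad, ← hw, aeval_hCxNAv, aeval_hCxNBv, aeval_hLxQv, div_div,
          ← mul_div_mul_right (2 * (s : ℝ) * m * q2 * γ * q1 ^ 2 * ρ *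
            ((e : ℝ) / 3 * v 0 ^ 3 + -((e : ℝ) * ρ ^ 2) * v 0)) ((e : ℝ) * (v 0 + ρ) ^ 2) hw0, ← add_div,
          div_eq_div_iff (mul_ne_zero hD hw0) (mul_ne_zero hQ0 hw0)]
        push_cast at hw2 ⊢
        linear_combination ((γ : ℝ) * q1 * ρ * ((e : ℝ) / 3 * v 0 ^ 3 + -((e : ℝ) * ρ ^ 2) * v 0) * (e : ℝ) ^ 2 *
            (v 0 + ρ) ^ 2 * w * (q2 : ℝ) ^ 2 * (v 0 - ρ) * w ^ 2) * hs2 +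
          ((γ : ℝ) * q1 * ρ * ((e : ℝ) / 3 * v 0 ^ 3 + -((e : ℝ) * ρ ^ 2) * v 0) * (e : ℝ) ^ 2 *
            (v 0 + ρ) ^ 2 * w * (q2 : ℝ) ^ 2 * (v 0 - ρ)) * hw2
  · -- a rational hull `[lo, 1]` free of zeros of `H`
    obtain ⟨lo, hQh, hdomh⟩ : ∃ lo : ℚ,
        (∀ x : ℝ, (lo : ℝ) ≤ x → x ≤ ((1 : ℚ) : ℝ) → Polynomial.aeval x (hP e g ^ 2) ≠ 0) ∧
        (∀ v ∈ r.domain, (lo : ℝ) ≤ v 0 ∧ v 0 ≤ ((1 : ℚ) : ℝ)) := by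
      rcases lt_or_ge 0 g with hg | hg
      · -- `g > 0`: hull `[0, 1]`
        have hg0 : (0 : ℝ) < g := by exact_mod_cast hg
        refine ⟨0, fun x hx _ => ?_, hI01⟩
        have hx0 : (0 : ℝ) ≤ x := by exact_mod_cast hx
        rw [map_pow, aeval_hP]
        exact pow_ne_zero 2 (add_pos_of_nonneg_of_pos (mul_nonneg he0.le (sq_nonneg x)) hg0).ne'
      · -- `g ≤ 0`, `ℓ(x⋆) ≠ 0`: `Δ(x⋆) < 0` and the domain stays away from `x⋆`
        have hlam : (q0 : ℝ) + q1 * xs ≠ 0 := fun h => hvx ⟨hg, h⟩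
        have hg0 : (g : ℝ) ≤ 0 := by exact_mod_cast hg
        have hxs2 : xs ^ 2 = -(g : ℝ) / e := by
          rw [hxs, Real.sq_sqrt (div_nonneg (neg_nonneg.2 hg0) he0.le)]
        have hexs : (e : ℝ) * xs ^ 2 + g = 0 := by
          rw [hxs2]; field_simp; ring
        have hgt : ∀ v ∈ r.domain, xs < v 0 := fun v hv => by
          obtain ⟨⟨h0, -⟩, hH, -⟩ := hdom v hv
          have hv0 : 0 < v 0 := lt_of_le_of_ne h0 fun h => by
            rw [← h] at hH; norm_num at hH; linarith
          rw [hxs, Real.sqrt_lt' hv0, div_lt_iff₀ he0]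
          nlinarith
        have hq2 : (0 : ℝ) ≤ (q2 : ℝ) ^ 2 := sq_nonneg _
        have hDxs : ((m : ℝ) + q2 ^ 2) * ((e : ℝ) * xs ^ 2 + g) - m * ((q0 : ℝ) + q1 * xs) ^ 2 < 0 := by
          have h2 : 0 < ((q0 : ℝ) + q1 * xs) ^ 2 :=
            lt_of_le_of_ne (sq_nonneg _) (Ne.symm (pow_ne_zero 2 hlam))
          rw [hexs, mul_zero, zero_sub]
          exact neg_neg_of_pos (mul_pos hm0 h2)
        have hcont : Continuous fun x : ℝ =>
            ((m : ℝ) + q2 ^ 2) * ((e : ℝ) * x ^ 2 + g) - m * ((q0 : ℝ) + q1 * x) ^ 2 := by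
          fun_prop
        obtain ⟨ε, hε, hball⟩ := Metric.eventually_nhds_iff.1
          (hcont.continuousAt.eventually_lt continuousAt_const hDxs)
        obtain ⟨lo, hlo1, hlo2⟩ := exists_rat_btwn (show xs < xs + ε by linarith)
        have hge : ∀ v ∈ r.domain, xs + ε ≤ v 0 := fun v hv => by
          obtain ⟨-, -, hΔ⟩ := hdom v hv
          refine not_lt.1 fun hlt => ?_
          have hd : dist (v 0) xs < ε := by
            rw [Real.dist_eq, abs_of_pos (sub_pos.2 (hgt v hv))]; linarith
          have h1 := hball hd
          linarith
        refine ⟨lo, fun x hx _ => ?_, fun v hv => ?_⟩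
        · rw [map_pow, aeval_hP]
          have hx0 : xs < x := by linarith
          have h1 : xs ^ 2 < x ^ 2 := by nlinarith
          rw [hxs2, div_lt_iff₀ he0] at h1
          exact pow_ne_zero 2 (show (0 : ℝ) < e * x ^ 2 + g by nlinarith).ne'
        · obtain ⟨⟨-, h1⟩, -⟩ := hdom v hv
          exact ⟨by linarith [hge v hv], by exact_mod_cast h1⟩
    refine InBaker.peel_rat (hCxNA e g m γ q0 q1 q2 s) (hP e g ^ 2) lo 1 hQh r hdomh
      (fun v => Polynomial.aeval (v 0) (hCxNB e g m γ q0 q1 q2) / Polynomial.aeval (v 0) (hP e g ^ 2) /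
        √(qD ((m + q2 ^ 2) * e - m * q1 ^ 2) (-(2 * m * q0 * q1)) ((m + q2 ^ 2) * g - m * q0 ^ 2) (v 0)))
      (fun v hv => ?_) fun rB hBd hBi =>
        InBaker.sqrt_rational_div _ _ _ hE' hH' (hCxNB e g m γ q0 q1 q2) (hP e g ^ 2) lo 1 hQh rB
          (fun v hv => hdomh v (by rw [hBd] at hv; exact hv)) hBi
    -- the integrand identity
    obtain ⟨⟨h0, -⟩, hH, hΔ⟩ := hdom v hv
    have hpos : 0 < qD ((m + q2 ^ 2) * e - m * q1 ^ 2) (-(2 * m * q0 * q1)) ((m + q2 ^ 2) * g - m * q0 ^ 2)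
        (v 0) := by
      rw [← hCx_rad]; exact hΔ
    obtain ⟨w, hw⟩ : ∃ w : ℝ, w = √(qD ((m + q2 ^ 2) * e - m * q1 ^ 2) (-(2 * m * q0 * q1))
        ((m + q2 ^ 2) * g - m * q0 ^ 2) (v 0)) := ⟨_, rfl⟩
    have hw0 : w ≠ 0 := by rw [hw]; exact (Real.sqrt_pos.2 hpos).ne'
    have hw2 : w ^ 2 = ((m : ℝ) + q2 ^ 2) * ((e : ℝ) * v 0 ^ 2 + g) - m * ((q0 : ℝ) + q1 * v 0) ^ 2 := by
      rw [hw, Real.sq_sqrt hpos.le, ← hCx_rad]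
    have hD : ((e : ℝ) * v 0 ^ 2 + g) ^ 2 ≠ 0 := pow_ne_zero 2 hH.ne'
    rw [hri hv]
    dsimp only
    rw [hCx_rad, ← hw, aeval_hCxNA, aeval_hCxNB, map_pow, aeval_hP, div_div,
      ← mul_div_mul_right (2 * (s : ℝ) * m * q2 * γ * ((e : ℝ) / 3 * v 0 ^ 3 + g * v 0) *
        ((q1 : ℝ) * g - e * q0 * v 0) * ((q0 : ℝ) + q1 * v 0)) (((e : ℝ) * v 0 ^ 2 + g) ^ 2) hw0, ← add_div,
      div_left_inj' (mul_ne_zero hD hw0)]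
    linear_combination ((γ : ℝ) * ((e : ℝ) / 3 * v 0 ^ 3 + g * v 0) *
        ((q1 : ℝ) * g - e * q0 * v 0) * (q2 : ℝ) ^ 2 * w ^ 2) * hs2 +
      ((γ : ℝ) * ((e : ℝ) / 3 * v 0 ^ 3 + g * v 0) *
        ((q1 : ℝ) * g - e * q0 * v 0) * (q2 : ℝ) ^ 2) * hw2

/-! #### 54.3 The conic-edge residual reduced to its degenerate radicands -/

/-- **`R-HCx` from its degenerate part `R-HCx°`.**  `R-HCx°` is `R-HCx` restricted to the radicands with
`E′ (4 E′ G′ − F′²) = 0` (`E′ = (m + q₂²) e − m q₁²`, `F′ = −2 m q₀ q₁`, `G′ = (m + q₂²) g − m q₀²`).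
Everything else is `InBaker.of_HCx_generic`. [this node] -/
theorem InBaker.of_Hconics_x
    (hdeg : (∀ (e g m γ q0 q1 q2 s : ℚ), 0 < e → 1 ≤ m → (s = 1 ∨ s = -1) →
      ((m + q2 ^ 2) * e - m * q1 ^ 2) *
          (4 * ((m + q2 ^ 2) * e - m * q1 ^ 2) * ((m + q2 ^ 2) * g - m * q0 ^ 2) - (2 * m * q0 * q1) ^ 2) = 0 →
      ∀ (S : Set (Fin 1 → ℝ)), IsSemialgebraic ℚ S →
        (∀ t ∈ S, (0 ≤ t 0 ∧ t 0 ≤ 1) ∧ 0 < (e : ℝ) * t 0 ^ 2 + g ∧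
          0 < ((m : ℝ) + q2 ^ 2) * ((e : ℝ) * t 0 ^ 2 + g) - m * ((q0 : ℝ) + q1 * t 0) ^ 2) →
        ∀ r : KZ.IntegralRep 1, r.domain = S →
          EqOn r.integrand (fun t => (γ : ℝ) * ((e : ℝ) / 3 * t 0 ^ 3 + g * t 0) * ((q1 : ℝ) * g - e * q0 * t 0) *
            ((m : ℝ) * ((q0 : ℝ) + q1 * t 0) +
              s * q2 * √(((m : ℝ) + q2 ^ 2) * ((e : ℝ) * t 0 ^ 2 + g) - m * ((q0 : ℝ) + q1 * t 0) ^ 2)) ^ 2 /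
            (((e : ℝ) * t 0 ^ 2 + g) ^ 2 *
              √(((m : ℝ) + q2 ^ 2) * ((e : ℝ) * t 0 ^ 2 + g) - m * ((q0 : ℝ) + q1 * t 0) ^ 2))) S →
          InBaker (KZ.of r))) :
    (∀ (e g m γ q0 q1 q2 s : ℚ), 0 < e → 1 ≤ m → (s = 1 ∨ s = -1) →
      ∀ (S : Set (Fin 1 → ℝ)), IsSemialgebraic ℚ S →
        (∀ t ∈ S, (0 ≤ t 0 ∧ t 0 ≤ 1) ∧ 0 < (e : ℝ) * t 0 ^ 2 + g ∧
          0 < ((m : ℝ) + q2 ^ 2) * ((e : ℝ) * t 0 ^ 2 + g) - m * ((q0 : ℝ) + q1 * t 0) ^ 2) →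
        ∀ r : KZ.IntegralRep 1, r.domain = S →
          EqOn r.integrand (fun t => (γ : ℝ) * ((e : ℝ) / 3 * t 0 ^ 3 + g * t 0) * ((q1 : ℝ) * g - e * q0 * t 0) *
            ((m : ℝ) * ((q0 : ℝ) + q1 * t 0) +
              s * q2 * √(((m : ℝ) + q2 ^ 2) * ((e : ℝ) * t 0 ^ 2 + g) - m * ((q0 : ℝ) + q1 * t 0) ^ 2)) ^ 2 /
            (((e : ℝ) * t 0 ^ 2 + g) ^ 2 *
              √(((m : ℝ) + q2 ^ 2) * ((e : ℝ) * t 0 ^ 2 + g) - m * ((q0 : ℝ) + q1 * t 0) ^ 2))) S →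
          InBaker (KZ.of r)) := by
  intro e g m γ q0 q1 q2 s he hm hs S hS hdom r hrd hri
  by_cases hnd : ((m + q2 ^ 2) * e - m * q1 ^ 2) *
      (4 * ((m + q2 ^ 2) * e - m * q1 ^ 2) * ((m + q2 ^ 2) * g - m * q0 ^ 2) - (2 * m * q0 * q1) ^ 2) = 0
  · exact hdeg e g m γ q0 q1 q2 s he hm hs hnd S hS hdom r hrd hri
  · exact InBaker.of_HCx_generic e g m γ q0 q1 q2 s he hm hs hnd S hS hdom r hrd hri

/-! #### 54.4 The descent from the degenerate residuals -/

/-- **`QuadricBakerDescent` from the degenerate one-variable residual families** (this node, generation 9,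
final form).  The three hypotheses are, in order:
* `R-HLx°` — the line-edge family of part 51 RESTRICTED to the degenerate radicands
  `(e − m κ₁²)(4 (e − m κ₁²)(g − m κ₀²) − (2 m κ₀ κ₁)²) = 0` (part 53 closes the rest);
* `R-HCx°` — the conic-edge family of part 52 RESTRICTED to the degenerate radicands
  `E′ (4 E′ G′ − (2 m q₀ q₁)²) = 0`, `E′ = (m + q₂²) e − m q₁²`, `G′ = (m + q₂²) g − m q₀²` (part 54 closes
  the rest);
* `R-Eθ` — the E-type corner atoms of part 43.
In both one-variable families the radicand is then LINEAR, CONSTANT or a PERFECT SQUARE: after the sign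
split at the double root the integrand is `R(x) · √c` or `R(x) · √(f x + g)` with `R ∈ ℚ(x)`
(`linear_factor`, `sqrt_const*`, `odd_factor` terminals after an `x ↦ x²` substitution).
[KontsevichZagier2001 §1.2; this node] -/
theorem quadricBakerDescent_of_residuals₇
    (hx : (∀ (e g m γ k0 k1 : ℚ), 0 < e → 1 ≤ m →
      (e - m * k1 ^ 2) * (4 * (e - m * k1 ^ 2) * (g - m * k0 ^ 2) - (2 * m * k0 * k1) ^ 2) = 0 →
      ∀ (S : Set (Fin 1 → ℝ)), IsSemialgebraic ℚ S →
        (∀ t ∈ S, (0 ≤ t 0 ∧ t 0 ≤ 1) ∧ 0 < (e : ℝ) * t 0 ^ 2 + g ∧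
          (m : ℝ) * ((k0 : ℝ) + k1 * t 0) ^ 2 < (e : ℝ) * t 0 ^ 2 + g) →
        ∀ r : KZ.IntegralRep 1, r.domain = S →
          EqOn r.integrand (fun t => (γ : ℝ) * ((e : ℝ) / 3 * t 0 ^ 3 + g * t 0) *
            √((e : ℝ) * t 0 ^ 2 + g - m * ((k0 : ℝ) + k1 * t 0) ^ 2) *
            (((k1 : ℝ) * g - e * k0 * t 0) / ((e : ℝ) * t 0 ^ 2 + g) ^ 2)) S →
          InBaker (KZ.of r)))
    (hc : (∀ (e g m γ q0 q1 q2 s : ℚ), 0 < e → 1 ≤ m → (s = 1 ∨ s = -1) →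
      ((m + q2 ^ 2) * e - m * q1 ^ 2) *
          (4 * ((m + q2 ^ 2) * e - m * q1 ^ 2) * ((m + q2 ^ 2) * g - m * q0 ^ 2) - (2 * m * q0 * q1) ^ 2) = 0 →
      ∀ (S : Set (Fin 1 → ℝ)), IsSemialgebraic ℚ S →
        (∀ t ∈ S, (0 ≤ t 0 ∧ t 0 ≤ 1) ∧ 0 < (e : ℝ) * t 0 ^ 2 + g ∧
          0 < ((m : ℝ) + q2 ^ 2) * ((e : ℝ) * t 0 ^ 2 + g) - m * ((q0 : ℝ) + q1 * t 0) ^ 2) →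
        ∀ r : KZ.IntegralRep 1, r.domain = S →
          EqOn r.integrand (fun t => (γ : ℝ) * ((e : ℝ) / 3 * t 0 ^ 3 + g * t 0) * ((q1 : ℝ) * g - e * q0 * t 0) *
            ((m : ℝ) * ((q0 : ℝ) + q1 * t 0) +
              s * q2 * √(((m : ℝ) + q2 ^ 2) * ((e : ℝ) * t 0 ^ 2 + g) - m * ((q0 : ℝ) + q1 * t 0) ^ 2)) ^ 2 /
            (((e : ℝ) * t 0 ^ 2 + g) ^ 2 *
              √(((m : ℝ) + q2 ^ 2) * ((e : ℝ) * t 0 ^ 2 + g) - m * ((q0 : ℝ) + q1 * t 0) ^ 2))) S →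
          InBaker (KZ.of r)))
    (hθ : (∀ (L : Quadric₃) (ℓ₁ ℓ₂ g : Wall) (γ : ℚ) (σ : Fin 6 → SignType) (r : KZ.IntegralRep 2),
      0 < L.dq.disc →
      ¬((L.bwall ℓ₁).precomp L.dq.lagM.inv ∈ goodWalls 1 L.dq.eκ L.dq.d11 L.dq.cst ∧
          (L.bwall ℓ₂).precomp L.dq.lagM.inv ∈ goodWalls 1 L.dq.eκ L.dq.d11 L.dq.cst) →
      r.domain = atomFam (L.wfam ℓ₁ ℓ₂ g) σ →
      EqOn r.integrand (fun v => (γ : ℝ) * √(L.Dxy (v 0) (v 1))) r.domain → InBaker (KZ.of r))) :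
    Summit.KontsevichZagierPeriods.KontsevichZagierPeriods.Theses.RootDecompWalshStrata.QuadricBakerDescent :=
  quadricBakerDescent_of_residuals₆ hx (InBaker.of_Hconics_x hc) hθ

end Summit.KontsevichZagierPeriods.RootDecompWalshStrata.ConicDescent.BallCube
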